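import Summits.HodgeConjecture.HodgeConjecture.Theorems.Ring2AbelianAllSpreadPerClass
import Literature.AlgebraicGeometry.HodgeTheory.LefschetzDecompositionSingular
import Literature.AlgebraicGeometry.HodgeTheory.HardLefschetzNFoldHolds
import Literature.AlgebraicGeometry.HodgeTheory.LefschetzOneOneHolds
import Literature.AlgebraicGeometry.HodgeTheory.HodgeTypeConjugation
import HarnessLib

/-!
# Ring 2 · sub-cell AbelianAll (ALL ABELIAN VARIETIES), SPREADING axis, part XIV — the per-class floor
# restricted to LEFSCHETZ-PRIMITIVE classes in the deep middle, licensed by a fact-free single-variety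
# reduction of the Hodge conjecture to primitive classes

HONEST FRAMING (page 1, verbatim): **research route, not a corollary; conditional on HC_CM plus one named
minimal statement.** Nothing in this file proves a case of the Hodge conjecture for a complex abelian variety of
dimension `≥ 4`; every `@[conjecture]` node below is OPEN, is used only as a displayed HYPOTHESIS, and "minimal"
is NOT claimed (LEAD ruling F-ab-4: least node of the typed preorder as it stands, no HC_CM-free converse known).
Seat `pub-hodge-ring2-ab-spread-1`, gen 24; helper file `--supports stmt-HodgeConjecture-16267`
(`RankFourFaces.CMToAbelian`, which stays OPEN). Docstring rev 2 (gen 25): REFEREE-AB F-ab-96 / F-ab-97 wording only —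
0 statement / proof bytes moved.

## What is new (gen-23 trigger (x), served here)

Part VII (`Ring2AbelianAllSpreadPerClass`) typed the per-class failure floor
`F_CM := HodgeFailureSpreadsToCMFibre` with the fact-free kernel `HC_AV ↔ HC_CM ∧ F_CM`. Its binder ranges over
ALL rational `(p,p)` classes on all complex abelian varieties. The tree already knows, with its facts DISCHARGED,
that only the deep middle `2 ≤ p`, `2p ≤ dim A` matters (Lefschetz `(1,1)` `lefschetzOneOne_rational_holds`, hard
Lefschetz `nonempty_hardLefschetzNFold_holds`; cf. `HodgeAbelianVarieties.Negative.hodgeAbelianVarieties_iff_deepMiddle`,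
which takes the facts as hypotheses and is stated for abelian varieties). What the tree did NOT have is the reduction
WITHIN each degree to the LEFSCHETZ-PRIMITIVE classes `P^{2p} = ker L^{n-2p+1} ⊆ H^{2p}` (Voisin I Def. 6.24,
`primitiveClasses`): the route file `HolomorphicityRateRateGapOfHodgePrimitive` has only the middle-degree first step
`exists_primitive_add_lefschetzOperator` (`2p = n`) and then LEAVES the variety through hyperplane sections, which is
useless for a statement quantified over abelian varieties only.

* §1 (generic, fact-free, any smooth projective `X`): `exists_mem_primitiveClasses_add_lefschetzOperator` — in EVERY
  degree `2(l+1) ≤ n`, a rational `(l+1,l+1)` class is `c = c₀ + [H] ∪ c'` with `c₀ ∈ P^{2(l+1)}` rational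
  `(l+1,l+1)` and `c'` rational `(l,l)` (hard Lefschetz bijectivity of `L^{n-2l} : H^{2l} → H^{2n-2l}` and the
  rationality / Hodge-type descent fields of `HardLefschetzNFold`); `mem_algebraicClasses_of_forall_mem_primitiveClasses`
  — if the rational `(p,p)` Λ-primitive classes with `2 ≤ p`, `2p ≤ n` are algebraic then ALL rational `(p,p)`
  classes are (strong induction on `p`; `p = 0`, `p = 1`, `2p > n` from the tree); packaged as
  `hodgeConjectureFor_iff_forall_mem_primitiveClasses`. In print: Voisin I Thm. 6.25 / Cor. 6.26 / Rem. 6.27 with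
  §7.1.2 and Thm. 11.30; Kerr–Pearlstein 2011 §3.1 (the standard remark that Hodge reduces to primitive middle
  cohomology). No named fact is consumed (the two `_holds` theorems are theorems of the tree).
* §2 (the node) `F_CM^prim := PrimitiveHodgeFailureSpreadsToCMFibre` — F_CM's conclusion demanded ONLY for
  offending classes which are Λ-primitive for some hard Lefschetz datum `Λ` of `A` and lie in the deep middle.
  Rows, all with NO named fact: `F_CM ⟹ F_CM^prim` (restriction of instances); **`HC_CM ∧ F_CM^prim ⟹ HC_AV`**
  (§1 + part VII's CM-fibre algebraicity); `HC_AV ⟹ F_CM^prim` (vacuously); hence `HC_AV ↔ HC_CM ∧ F_CM^prim`,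
  `ModCM F_CM^prim ↔ CMToAbelian`, `F_CM^prim ↔ F_CM ↔ HC_AV` under `HC_CM` alone, and `F_CM^prim` from the summit.
* §3 the same reduction packaged for the sub-cell: `HC_AV ↔` "every rational `(p,p)` Λ-primitive class in the deep
  middle of a complex abelian variety is algebraic", NO named fact (`HC_AV_iff_forall_mem_primitiveClasses`).

HONEST LIMITS. (i) The converse `F_CM^prim ⟹ F_CM` is NOT proved HC_CM-free (a non-primitive offender `c = c₀ + [H] ∪ c'`
has an offending primitive part `c₀` or an offending `c'` of lower codimension, but F_CM^prim's anchored datum for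
`c₀` / for the primitive part of `c'` is not an anchored datum for `c`); under `HC_CM` the two nodes coincide (both are
`↔ HC_AV`). So F_CM^prim sits BELOW F_CM in the HC_CM-free preorder by a typed edge whose reverse is open: it is the
least node TYPED SO FAR — not a canonical floor: the restriction move is NOT exhausted (REFEREE-AB F-ab-96), since
`∀ A, ∃ Λ, …` (from F_CM^prim by `nonempty_hardLefschetzNFold_holds`; the closing proof below uses ONE arbitrary `Λ`),
one fixed polarisation datum per `A`, one `p`, or one degree are weaker-LOOKING typed sentences by the SAME move, each
still closing with `HC_CM`, none typed here — and "minimal" is still not claimed. (ii) The restriction is licensed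
by a THEOREM (§1), not by a new hypothesis: the B_min of record changes its binder, not its logical strength modulo
`HC_CM`.
(iii) For `dim A ≤ 3` the binder of F_CM^prim is EMPTY (no `p` with `2 ≤ p`, `2p ≤ 3`) — consistent with the tree's
`hodgeConjecture_of_dim_le_three_holds`; the first instance is `dim A = 4`, `p = 2`, `c ∈ P⁴(A) = ker(L : H⁴ → H⁶)`.

References: VoisinHodgeI2002 (§6.2.3 Def. 6.24, Thm. 6.25, Cor. 6.26, Rem. 6.27, §7.1.2, Thm. 11.30);
VoisinHodgeII2003 (§9.2.4 Prop. 9.20); KerrPearlstein2011 (§3.1); Deligne1982HodgeCycles (§6, Prop. 6.1);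
Andre1996Motifs (Lemme 6.3.1); Milne1999 (§7 hypothesis (H)).
-/

noncomputable section

set_option linter.dupNamespace false

open CategoryTheory AlgebraicGeometry
open Literature.AlgebraicGeometry Literature.AlgebraicGeometry.Motives
open Literature.AlgebraicGeometry.HodgeTheory
open Literature.Geometry.Kaehler (lefschetzOperator)

/-! ## §1 The single-variety reduction of the Hodge conjecture to Lefschetz-primitive classes (generic, fact-free) -/

namespace Summit.HodgeConjecture.HodgeConjecture.Theorems

/-- **First step of the Lefschetz decomposition in EVERY degree `2(l+1) ≤ n`, with rationality and Hodge types.**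
On a smooth projective `n`-fold with a hard Lefschetz datum `Λ` (`[H] = Λ.hyperplaneClass`), every rational class `c`
of type `(l+1,l+1)` in `H^{2(l+1)}`, `2(l+1) ≤ n`, is `c = c₀ + [H] ∪ c'` with `c₀ ∈ P^{2(l+1)} = ker L^{n-2l-1}`
rational of type `(l+1,l+1)` and `c' ∈ H^{2l}` rational of type `(l,l)`: writing `n = 2(l+1) + i`, take `c'` with
`L^{i+2} c' = L^{i+1} c` (`L^{i+2} : H^{2l} → H^{2n-2l}` is bijective, Thm. 6.25; `c'` is rational and of type `(l,l)`
because `L^{i+1} c` is rational of type `(l+i+2, l+i+2)`, §7.1.2 / Rem. 6.27 — the fields `isRationalClass_L_iff`,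
`isOfHodgeType_L_iff`), and `c₀ := c - [H] ∪ c'`, killed by `L^{i+1}`. The middle-degree case `i = 0` is the tree's
`exists_primitive_add_lefschetzOperator`. [cite: VoisinHodgeI2002, §6.2.3 Def. 6.24, Thm. 6.25, Cor. 6.26 and Rem. 6.27] -/
theorem exists_mem_primitiveClasses_add_lefschetzOperator {n l : ℕ} {X : SchemeOver ℂ}
    (hX : IsSmoothProjective n X) (Λ : HardLefschetzNFold n X) (hln : 2 * (l + 1) ≤ n)
    (c : complexBetti X (2 * (l + 1))) (hc : IsRationalClass c)
    (hpp : IsOfHodgeType n X (2 * (l + 1)) (l + 1) (l + 1) c) :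
    ∃ (c₀ : complexBetti X (2 * (l + 1))) (c' : complexBetti X (2 * l)),
      IsRationalClass c₀ ∧ IsOfHodgeType n X (2 * (l + 1)) (l + 1) (l + 1) c₀ ∧
        c₀ ∈ primitiveClasses Λ.hyperplaneClass n (2 * (l + 1)) ∧
          IsRationalClass c' ∧ IsOfHodgeType n X (2 * l) l l c' ∧
            c = c₀ + lefschetzOperator Λ.hyperplaneClass (two_add_two_mul l) c' := by
  -- `n = 2(l+1) + i`; the primitivity exponent in degree `2(l+1)` is `i + 1`
  obtain ⟨i, hi⟩ : ∃ i, n = 2 * (l + 1) + i := ⟨n - 2 * (l + 1), by omega⟩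
  have hm : 2 * (l + 1) + 2 * (i + 1) = 2 * (l + i + 2) := by omega
  have hjk : 2 * l + (1 + (i + 1)) = n := by omega
  have hm₂ : 2 * l + 2 * (1 + (i + 1)) = 2 * (l + i + 2) := by omega
  -- `d := L^{i+1} c`, rational of type `(l+i+2, l+i+2)`
  set d : complexBetti X (2 * (l + i + 2)) := Λ.L (i + 1) (2 * (l + 1)) (2 * (l + i + 2)) hm c with hd
  have hd_rat : IsRationalClass d := Λ.isRationalClass_L _ _ _ hm hc
  have hd_typ : IsOfHodgeType n X (2 * (l + i + 2)) (l + 1 + (i + 1)) (l + 1 + (i + 1)) d :=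
    Λ.isOfHodgeType_L (i + 1) (2 * (l + 1)) (2 * (l + i + 2)) hm (l + 1) (l + 1) hpp
  -- `L^{i+2} : H^{2l} → H^{2(l+i+2)}` is bijective (`2l + (i+2) = n`): `c'` with `L^{i+2} c' = d`
  obtain ⟨c', hc'⟩ := (Λ.bijective_L hjk (2 * (l + i + 2)) hm₂).2 d
  have hc'_rat : IsRationalClass c' := (Λ.isRationalClass_L_iff hjk _ hm₂ c').1 (hc' ▸ hd_rat)
  have hidx : l + 1 + (i + 1) = l + (1 + (i + 1)) := by omega
  have hc'_typ : IsOfHodgeType n X (2 * l) l l c' := by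
    refine (Λ.isOfHodgeType_L_iff hjk _ hm₂ l l c').1 ?_
    rw [hc', ← hidx]
    exact hd_typ
  -- `L^{i+2} c' = L^{i+1} ([H] ∪ c')`
  have hLL : lefschetzPowTo Λ.hyperplaneClass (1 + (i + 1)) (2 * l) (2 * (l + i + 2)) hm₂ c' =
      lefschetzPowTo Λ.hyperplaneClass (i + 1) (2 * (l + 1)) (2 * (l + i + 2)) hm
        (lefschetzOperator Λ.hyperplaneClass (two_add_two_mul l) c') := by
    have h₁ := lefschetzPowTo_lefschetzPowTo Λ.hyperplaneClass (i + 1) (j := 1) (k := 2 * l)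
      (m := 2 * (l + 1)) (s := 2 * (l + i + 2)) (by omega) hm hm₂ c'
    have h₂ := lefschetzPowTo_succ_apply Λ.hyperplaneClass 0 (2 * l) (2 * l) (2 * (l + 1)) rfl (by omega)
      (two_add_two_mul l) c'
    rw [lefschetzPowTo_zero_apply] at h₂
    rw [← h₁, h₂]
  -- the `L`-image of `c'` is rational of type `(l+1, l+1)`
  have hLc'_rat : IsRationalClass (lefschetzOperator Λ.hyperplaneClass (two_add_two_mul l) c') :=
    Λ.isRationalClass_hyperplaneClass.cup _ hc'_rat
  have hLc'_typ : IsOfHodgeType n X (2 * (l + 1)) (l + 1) (l + 1)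
      (lefschetzOperator Λ.hyperplaneClass (two_add_two_mul l) c') :=
    Λ.isOfHodgeType_lefschetzOperator _ _ (two_add_two_mul l) l l c' hc'_typ
  refine ⟨c - lefschetzOperator Λ.hyperplaneClass (two_add_two_mul l) c', c', ?_, hpp.sub hX hLc'_typ, ?_,
    hc'_rat, hc'_typ, (sub_add_cancel _ _).symm⟩
  · -- rationality of `c₀ = c - [H] ∪ c'`
    have hneg : IsRationalClass (-(lefschetzOperator Λ.hyperplaneClass (two_add_two_mul l) c')) := by
      simpa using hLc'_rat.smul (-1)
    simpa [sub_eq_add_neg] using hc.add hneg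
  · -- primitivity: `P^{2(l+1)} = ker L^{i+1}` (`2(l+1) + (i+1) = n + 1`) and `L^{i+1} c₀ = d - L^{i+2} c' = 0`
    rw [primitiveClasses_eq_ker Λ.hyperplaneClass n hln (show 2 * (l + 1) + (i + 1) = n + 1 by omega) hm,
      LinearMap.mem_ker, map_sub, ← hLL]
    change d - Λ.L (1 + (i + 1)) (2 * l) (2 * (l + i + 2)) hm₂ c' = 0
    rw [hc', sub_self]

/-- **The Hodge conjecture for `X` follows from the Hodge conjecture for its LEFSCHETZ-PRIMITIVE classes in the deep
middle** (fact-free; any smooth projective `n`-fold, any hard Lefschetz datum `Λ`). If every rational `(p,p)` class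
`c ∈ P^{2p} = ker(L^{n-2p+1} : H^{2p} → H^{2n-2p+2})` with `2 ≤ p`, `2p ≤ n` is algebraic, then every rational `(p,p)`
class is algebraic, in every codimension `p`: strong induction on `p` — `p = 0` (`algebraicClasses_zero`), `p = 1`
(Lefschetz `(1,1)`, the tree's theorem `lefschetzOneOne_rational_holds`), `2p > n` (hard Lefschetz down to codimension
`n - p < p`, `HardLefschetzNFold.mem_algebraicClasses_of_lt`), and `2 ≤ p`, `2p ≤ n`: `c = c₀ + [H] ∪ c'`
(`exists_mem_primitiveClasses_add_lefschetzOperator`), `c₀` algebraic by hypothesis, `c'` by induction, `[H] ∪ c'`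
by `HardLefschetzNFold.lefschetzOperator_mem_algebraicClasses`. [cite: VoisinHodgeI2002, Thm. 6.25, Cor. 6.26, Rem. 6.27,
§7.1.2 and Thm. 11.30] [cite: VoisinHodgeII2003, §9.2.4 Prop. 9.20] [cite: KerrPearlstein2011, §3.1] -/
theorem mem_algebraicClasses_of_forall_mem_primitiveClasses {n : ℕ} {X : SchemeOver ℂ}
    (hX : IsSmoothProjective n X) (Λ : HardLefschetzNFold n X)
    (hprim : ∀ p : ℕ, 2 ≤ p → 2 * p ≤ n → ∀ c : complexBetti X (2 * p), IsRationalClass c →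
      IsOfHodgeType n X (2 * p) p p c → c ∈ primitiveClasses Λ.hyperplaneClass n (2 * p) →
        c ∈ algebraicClasses X p) :
    ∀ (p : ℕ) (c : complexBetti X (2 * p)), IsRationalClass c → IsOfHodgeType n X (2 * p) p p c →
      c ∈ algebraicClasses X p := by
  intro p
  induction p using Nat.strong_induction_on with
  | _ p ih =>
  intro c hc hpp
  rcases Nat.lt_or_ge n (2 * p) with hnp | hpn
  · -- above the middle: down to codimension `n - p < p`
    exact Λ.mem_algebraicClasses_of_lt hnp (fun c' hc' hpp' ↦ ih (n - p) (by omega) c' hc' hpp') c hc hpp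
  · rcases p with _ | _ | l
    · -- `p = 0`
      rw [algebraicClasses_zero]
      exact Submodule.mem_top
    · -- `p = 1`: Lefschetz `(1,1)`
      exact lefschetzOneOne_rational_holds hX c hc hpp
    · -- `p = l + 2`, `2p ≤ n`: first Lefschetz step, primitive part by `hprim`, the rest by induction
      obtain ⟨c₀, c', hc₀_rat, hc₀_typ, hc₀_prim, hc'_rat, hc'_typ, hsum⟩ :=
        exists_mem_primitiveClasses_add_lefschetzOperator hX Λ hpn c hc hpp
      rw [hsum]
      exact Submodule.add_mem _ (hprim (l + 1 + 1) (by omega) hpn c₀ hc₀_rat hc₀_typ hc₀_prim)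
        (Λ.lefschetzOperator_mem_algebraicClasses (l + 1) c' (ih (l + 1) (by omega) c' hc'_rat hc'_typ))

/-- **`HodgeConjectureFor n X ↔` the Hodge conjecture for the Λ-primitive rational `(p,p)` classes of `X` with
`2 ≤ p`, `2p ≤ n`** (fact-free; `X` smooth projective, `Λ` any hard Lefschetz datum; the Hodge model exists by the
tree's theorem `nonempty_hodgeModel_holds`). [cite: VoisinHodgeI2002, Thm. 6.25, Cor. 6.26, Rem. 6.27 and Thm. 11.30]
[cite: KerrPearlstein2011, §3.1] -/
theorem hodgeConjectureFor_iff_forall_mem_primitiveClasses {n : ℕ} {X : SchemeOver ℂ}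
    (hX : IsSmoothProjective n X) (Λ : HardLefschetzNFold n X) :
    HodgeConjectureFor n X ↔
      ∀ p : ℕ, 2 ≤ p → 2 * p ≤ n → ∀ c : complexBetti X (2 * p), IsRationalClass c →
        IsOfHodgeType n X (2 * p) p p c → c ∈ primitiveClasses Λ.hyperplaneClass n (2 * p) →
          c ∈ algebraicClasses X p :=
  ⟨fun h p _ _ c hc hpp _ ↦ ((hodgeConjectureFor_iff_of_isSmoothProjective nonempty_hodgeModel_holds hX).1 h)
      p c hc hpp,
    fun h ↦ (hodgeConjectureFor_iff_of_isSmoothProjective nonempty_hodgeModel_holds hX).2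
      (mem_algebraicClasses_of_forall_mem_primitiveClasses hX Λ h)⟩

/-- Sanity (`n ≤ 3`): the primitive hypothesis is EMPTY, so §1 re-derives the tree's "Hodge in dimension `≤ 3`"
for smooth projective varieties carrying a hard Lefschetz datum (cf. `hodgeConjecture_of_dim_le_three_holds`).
[cite: VoisinHodgeII2003, §10.2.3 proof of Prop. 10.26] -/
example {n : ℕ} {X : SchemeOver ℂ} (hX : IsSmoothProjective n X) (Λ : HardLefschetzNFold n X) (hn : n ≤ 3) :
    HodgeConjectureFor n X :=
  (hodgeConjectureFor_iff_forall_mem_primitiveClasses hX Λ).2 fun p h2 h2p ↦ absurd h2p (by omega)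

end Summit.HodgeConjecture.HodgeConjecture.Theorems

/-! ## §2 The node `F_CM^prim` and its fact-free rows -/

namespace Summit.HodgeConjecture.HodgeConjecture.Ring2.AbelianAll

open Summit.HodgeConjecture.HodgeConjecture
open Summit.HodgeConjecture.HodgeConjecture.Theorems
open Summit.HodgeConjecture.HodgeConjecture.Theses
open Summit.HodgeConjecture.HodgeConjecture.Theses.RankFourFaces (CMAbelianHodge CMToAbelian)
open Summit.HodgeConjecture.HodgeConjecture.Theses.PadicSemiregularLift (HodgeAbelianVarieties)
open Summit.HodgeConjecture.HodgeConjecture.Ring2.Deform (cmLocus)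
open Summit.HodgeConjecture.HodgeConjecture.Theorems.HodgeAbelianVarieties.Negative (iff_hodgeConjecture_restricted)

/-- **`F_CM^prim` — HODGE FAILURES OF LEFSCHETZ-PRIMITIVE CLASSES IN THE DEEP MIDDLE SPREAD TO A CM FIBRE** (research
node; part VII's `HodgeFailureSpreadsToCMFibre` with its binder RESTRICTED). For every complex abelian variety `A`,
every hard Lefschetz datum `Λ` of `A` (`[H]` an ample class), every `p` with `2 ≤ p`, `2p ≤ dim A`, and every rational
`(p,p)` class `c ∈ P^{2p}(A) = ker(L^{dim A - 2p + 1})` which is NOT algebraic, there are an anchored datum `(f, s, W)`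
for `(A, p, c)` (part VII §A) and a CM fibre `s' ∈ cmLocus f n` at which `W` is NOT algebraic. KERNEL (this file,
NO named fact): `HC_AV ↔ HC_CM ∧ F_CM^prim`; `F_CM ⟹ F_CM^prim`; the converse is open HC_CM-free and the two coincide
under `HC_CM`. OPEN; no print locator of its own; a HYPOTHESIS wherever used; never asserted; "minimal" not claimed
(F-ab-4). First instance: `dim A = 4`, `p = 2`, `c ∈ ker([H] ∪ · : H⁴ → H⁶)`.
[cite: Deligne1982HodgeCycles, Prop. 6.1, Thm. 2.12 and Prop. 2.9] [cite: VoisinHodgeI2002, §6.2.3 Def. 6.24 and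
Cor. 6.26] [cite: Andre1996Motifs, Lemme 6.3.1 (p. 31)] [status: open] -/
@[conjecture] def PrimitiveHodgeFailureSpreadsToCMFibre : Prop :=
  ∀ (A : AbelianVariety ℂ), IsSmoothProjective A.dim A.X → ∀ (Λ : HardLefschetzNFold A.dim A.X)
    (p : ℕ), 2 ≤ p → 2 * p ≤ A.dim →
      ∀ (c : complexBetti A.X (2 * p)), IsRationalClass c → IsOfHodgeType A.dim A.X (2 * p) p p c →
        c ∈ primitiveClasses Λ.hyperplaneClass A.dim (2 * p) → c ∉ algebraicClasses A.X p →
          ∃ (n : ℕ) (𝒳 S : SchemeOver ℂ) (f : 𝒳 ⟶ S) (s : ComplexPoints S) (W : complexBetti 𝒳 (2 * p)),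
            IsCMAnchoredDatumFor A p c f n s W ∧
              ∃ s' ∈ cmLocus f n, complexBetti.map (fiberι f s') (2 * p) W ∉ algebraicClasses (fiberOver f s') p

/-- **`F_CM ⟹ F_CM^prim`**, NO fact: forget the extra binders. [folklore] -/
theorem primitiveHodgeFailureSpreadsToCMFibre_of_hodgeFailureSpreadsToCMFibre (h : HodgeFailureSpreadsToCMFibre) :
    PrimitiveHodgeFailureSpreadsToCMFibre :=
  fun A hA _ p _ _ c hc hpp _ hnc ↦ h A hA p c hc hpp hnc

/-- **`HC_CM ∧ F_CM^prim ⟹` Hodge for every complex abelian variety — NO named fact.** Take a hard Lefschetz datum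
`Λ` of `A` (`nonempty_hardLefschetzNFold_holds`); by §1 it suffices to treat a rational `(p,p)` Λ-primitive class `c`
with `2 ≤ p`, `2p ≤ dim A`; were it not algebraic, F_CM^prim gives an anchored datum and a CM fibre `s'` with
`W|_{𝒳_{s'}}` NOT algebraic, while `HC_CM` makes `W` algebraic at every CM fibre (part VII) — contradiction.
[cite: VoisinHodgeI2002, Thm. 6.25, Cor. 6.26 and Rem. 6.27] [cite: Milne1999, §7 p. 72 (hypothesis (H))]
[cite: Deligne1982HodgeCycles, §6 proof of Thm. 2.11 (pp. 71–73)] -/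
theorem hodgeConjecture_abelian_of_HC_CM_of_primitiveHodgeFailureSpreadsToCMFibre (hCM : CMAbelianHodge)
    (h : PrimitiveHodgeFailureSpreadsToCMFibre) :
    ∀ A : AbelianVariety ℂ, IsSmoothProjective A.dim A.X → HodgeConjectureFor A.dim A.X := by
  intro A hA
  obtain ⟨Λ⟩ := nonempty_hardLefschetzNFold_holds A.dim A.X hA
  refine (hodgeConjectureFor_iff_forall_mem_primitiveClasses hA Λ).2 ?_
  intro p h2 h2p c hc hpp hprim
  by_contra hnc
  obtain ⟨n, 𝒳, S, f, s, W, hd, s', hs', hns'⟩ := h A hA Λ p h2 h2p c hc hpp hprim hnc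
  exact hns' (forall_cmLocus_mem_algebraicClasses_of_HC_CM_of_isCMAnchoredDatumFor hCM hd s' hs')

/-- **`HC_AV_of_HC_CM_and_primitiveHodgeFailureSpreadsToCMFibre` — the brief's `HC_AV_of_HC_CM_and_Bmin` with
`B_min := F_CM^prim` and EXACTLY two hypotheses**: `HC_CM → F_CM^prim → HC_AV`, NO named fact.
[cite: Deligne1982HodgeCycles, §6 (pp. 71–73)] [cite: VoisinHodgeI2002, Cor. 6.26] -/
theorem HC_AV_of_HC_CM_and_primitiveHodgeFailureSpreadsToCMFibre (hCM : CMAbelianHodge)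
    (h : PrimitiveHodgeFailureSpreadsToCMFibre) : HodgeAbelianVarieties :=
  iff_hodgeConjecture_restricted.2 (hodgeConjecture_abelian_of_HC_CM_of_primitiveHodgeFailureSpreadsToCMFibre hCM h)

/-- F_CM^prim closes with `HC_CM`, NO fact (LEAD grammar). [folklore] -/
theorem closesWithCM_primitiveHodgeFailureSpreadsToCMFibre : ClosesWithCM PrimitiveHodgeFailureSpreadsToCMFibre :=
  fun hCM h ↦ HC_AV_of_HC_CM_and_primitiveHodgeFailureSpreadsToCMFibre hCM h

/-- Hence `F_CM^prim ⟹ CMToAbelian` outright (a typed conditional TOWARD stmt-HodgeConjecture-16267, which stays OPEN).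
[folklore] -/
theorem cmToAbelian_of_primitiveHodgeFailureSpreadsToCMFibre : PrimitiveHodgeFailureSpreadsToCMFibre → CMToAbelian :=
  cmToAbelian_of_closesWithCM closesWithCM_primitiveHodgeFailureSpreadsToCMFibre

/-- **ON-PATH with NO fact: `HC_AV ⟹ F_CM^prim`** — under `HC_AV` nothing triggers it. [folklore] -/
theorem onPathAV_primitiveHodgeFailureSpreadsToCMFibre : OnPathAV PrimitiveHodgeFailureSpreadsToCMFibre :=
  fun hAV A _ _ p _ _ c hc hpp _ hnc ↦ absurd ((hAV A).2 p c hc hpp) hnc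

/-- **EXACTNESS with NO named fact: `HC_AV ↔ (HC_CM ∧ F_CM^prim)`.** In print `HC_CM` is NOT known to follow from
F_CM^prim (KIND 2). [folklore] -/
theorem exactWithCM_primitiveHodgeFailureSpreadsToCMFibre : ExactWithCM PrimitiveHodgeFailureSpreadsToCMFibre :=
  exactWithCM_iff.2
    ⟨closesWithCM_primitiveHodgeFailureSpreadsToCMFibre, onPathAV_primitiveHodgeFailureSpreadsToCMFibre⟩

/-- The same, unfolded: `HC_AV ↔ (HC_CM ∧ F_CM^prim)`, NO named fact. [folklore] -/
theorem HC_AV_iff_HC_CM_and_primitiveHodgeFailureSpreadsToCMFibre :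
    HodgeAbelianVarieties ↔ (CMAbelianHodge ∧ PrimitiveHodgeFailureSpreadsToCMFibre) :=
  exactWithCM_primitiveHodgeFailureSpreadsToCMFibre

/-- Relativised to `HC_CM`, the primitive failure form IS the item: `ModCM F_CM^prim ↔ CMToAbelian`, NO named fact.
[folklore] -/
theorem modCM_primitiveHodgeFailureSpreadsToCMFibre_iff_cmToAbelian :
    ModCM PrimitiveHodgeFailureSpreadsToCMFibre ↔ CMToAbelian :=
  modCM_iff_cmToAbelian_of_exactWithCM exactWithCM_primitiveHodgeFailureSpreadsToCMFibre

/-- Under `HC_CM` alone (no print), `F_CM^prim ↔ HC_AV`. [folklore] -/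
theorem primitiveHodgeFailureSpreadsToCMFibre_iff_HC_AV_of_HC_CM (hCM : CMAbelianHodge) :
    PrimitiveHodgeFailureSpreadsToCMFibre ↔ HodgeAbelianVarieties :=
  iff_HC_AV_of_exactWithCM_of_HC_CM exactWithCM_primitiveHodgeFailureSpreadsToCMFibre hCM

/-- **COLLAPSE under `HC_CM` alone (no print): `F_CM^prim ↔ F_CM`** — the HC_CM-free converse `F_CM^prim ⟹ F_CM` is
NOT claimed. [folklore] -/
theorem primitiveHodgeFailureSpreadsToCMFibre_iff_hodgeFailureSpreadsToCMFibre_of_HC_CM (hCM : CMAbelianHodge) :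
    PrimitiveHodgeFailureSpreadsToCMFibre ↔ HodgeFailureSpreadsToCMFibre :=
  (primitiveHodgeFailureSpreadsToCMFibre_iff_HC_AV_of_HC_CM hCM).trans
    (hodgeFailureSpreadsToCMFibre_iff_HC_AV_of_HC_CM hCM).symm

/-- ON-PATH from the summit, NO fact. [folklore] -/
theorem primitiveHodgeFailureSpreadsToCMFibre_of_hodgeConjecture (hHC : _root_.HodgeConjecture) :
    PrimitiveHodgeFailureSpreadsToCMFibre :=
  of_onPathAV_of_hodgeConjecture onPathAV_primitiveHodgeFailureSpreadsToCMFibre hHC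

/-- **The B_min ladder of the spreading axis at this node, NO named fact**: `F_CM ⟹ F_CM^prim ⟹ CMToAbelian`, and
`HC_AV ↔ HC_CM ∧ F_CM ↔ HC_CM ∧ F_CM^prim`. [folklore] -/
theorem spreadFloor_primitive_ladder :
    (HodgeFailureSpreadsToCMFibre → PrimitiveHodgeFailureSpreadsToCMFibre) ∧
      (PrimitiveHodgeFailureSpreadsToCMFibre → CMToAbelian) ∧
        (HodgeAbelianVarieties ↔ (CMAbelianHodge ∧ HodgeFailureSpreadsToCMFibre)) ∧
          (HodgeAbelianVarieties ↔ (CMAbelianHodge ∧ PrimitiveHodgeFailureSpreadsToCMFibre)) :=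
  ⟨primitiveHodgeFailureSpreadsToCMFibre_of_hodgeFailureSpreadsToCMFibre,
    cmToAbelian_of_primitiveHodgeFailureSpreadsToCMFibre, HC_AV_iff_HC_CM_and_hodgeFailureSpreadsToCMFibre,
    HC_AV_iff_HC_CM_and_primitiveHodgeFailureSpreadsToCMFibre⟩

/-! ## §3 The reduction packaged for the sub-cell: `HC_AV` is the Hodge conjecture for deep-middle primitive classes -/

/-- **`HC_AV ↔` every rational `(p,p)` Λ-primitive class with `2 ≤ p`, `2p ≤ dim A` on every complex abelian variety
is algebraic** — for EVERY choice of hard Lefschetz data, NO named fact (the facts Lefschetz `(1,1)`, hard Lefschetz and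
Hodge models are theorems of the tree: `lefschetzOneOne_rational_holds`, `nonempty_hardLefschetzNFold_holds`,
`nonempty_hodgeModel_holds`; compare `HodgeAbelianVarieties.Negative.hodgeAbelianVarieties_iff_deepMiddle`, which has no
primitivity clause and takes the facts as hypotheses). [cite: VoisinHodgeI2002, Thm. 6.25, Cor. 6.26, Rem. 6.27 and
Thm. 11.30] [cite: KerrPearlstein2011, §3.1] -/
theorem HC_AV_iff_forall_mem_primitiveClasses :
    HodgeAbelianVarieties ↔
      ∀ (A : AbelianVariety ℂ) (Λ : HardLefschetzNFold A.dim A.X) (p : ℕ), 2 ≤ p → 2 * p ≤ A.dim →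
        ∀ c : complexBetti A.X (2 * p), IsRationalClass c → IsOfHodgeType A.dim A.X (2 * p) p p c →
          c ∈ primitiveClasses Λ.hyperplaneClass A.dim (2 * p) → c ∈ algebraicClasses A.X p := by
  refine ⟨fun h A Λ p _ _ c hc hpp _ ↦ (h A).2 p c hc hpp, fun h ↦ iff_hodgeConjecture_restricted.2 fun A hA ↦ ?_⟩
  obtain ⟨Λ⟩ := nonempty_hardLefschetzNFold_holds A.dim A.X hA
  exact (hodgeConjectureFor_iff_forall_mem_primitiveClasses hA Λ).2 (h A Λ)

/-- **A counterexample to `HC_AV`, if any, may be taken PRIMITIVE in the deep middle** (F-ab-97): `¬ HC_AV` iff some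
complex abelian variety carries, for EVERY hard Lefschetz datum `Λ`, a rational `(p,p)` Λ-primitive non-algebraic
class with `2 ≤ p`, `2p ≤ dim A` — NO named fact. [cite: VoisinHodgeI2002, Cor. 6.26] [cite: KerrPearlstein2011, §3.1] -/
theorem not_HC_AV_iff_exists_mem_primitiveClasses_not_mem :
    ¬ HodgeAbelianVarieties ↔
      ∃ A : AbelianVariety ℂ, ∀ Λ : HardLefschetzNFold A.dim A.X, ∃ (p : ℕ), 2 ≤ p ∧ 2 * p ≤ A.dim ∧
        ∃ c : complexBetti A.X (2 * p), IsRationalClass c ∧ IsOfHodgeType A.dim A.X (2 * p) p p c ∧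
          c ∈ primitiveClasses Λ.hyperplaneClass A.dim (2 * p) ∧ c ∉ algebraicClasses A.X p := by
  constructor
  · intro h
    by_contra hall
    push Not at hall
    refine h (iff_hodgeConjecture_restricted.2 fun A hA ↦ ?_)
    obtain ⟨Λ, hΛ⟩ := hall A
    exact (hodgeConjectureFor_iff_forall_mem_primitiveClasses hA Λ).2 hΛ
  · rintro ⟨A, hA⟩ hAV
    obtain ⟨Λ⟩ := nonempty_hardLefschetzNFold_holds A.dim A.X (AbelianVariety.isSmoothProjective_holds (A := A))
    obtain ⟨p, h2, h2p, c, hc, hpp, _, hnc⟩ := hA Λ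
    exact hnc ((hAV A).2 p c hc hpp)

end Summit.HodgeConjecture.HodgeConjecture.Ring2.AbelianAll

end
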